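import Mathlib

/-!
# Dual-cusp collapse — first lemma (integer/rational bookkeeping only; bsd-idea-19 g29)

For an additive potentially ordinary fibre with ramification index `e ∈ {2,3,4,6}` and
`v_p(Δ_min) = 12 k / e` with `k` coprime to `e`, the inertial digit is `b = k (p-1)/e`.
The two exponents appearing in the memo `Lines/two-parity-dual-cusp-digits.md` §5,
`b/(p-1) - 1/e = (k-1)/e` (★ at a middle cusp + local lemma `v^G_mid = -1/e`) and
`max(0, 2b-(p-1))/(p-1) = max(0, (2k-e)/e)` (THE LAW of g24), agree because `k ∈ {1, e-1}`.
Nothing about BSD, C5, R or K1 is proved here.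
-/

namespace Summit.BirchSwinnertonDyer.BirchSwinnertonDyer.Cruxes.ManinPrimeToAdditiveFiveLe.DualCuspCollapse

/-- The residues coprime to `e ∈ {2,3,4,6}` in `[1, e)` are `1` and `e - 1`. -/
theorem coprime_residue_eq (e k : ℕ) (he : e = 2 ∨ e = 3 ∨ e = 4 ∨ e = 6)
    (hk1 : 1 ≤ k) (hk : k < e) (hcop : Nat.Coprime k e) : k = 1 ∨ k = e - 1 := by
  rcases he with rfl | rfl | rfl | rfl <;> interval_cases k <;> simp_all (config := {decide := true})

/-- Collapse-exponent identity: for `k ∈ {1, e-1}` (`e ≥ 2`),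
`(k-1)/e = max 0 ((2k-e)/e)` in `ℚ`. -/
theorem collapse_exponent (e k : ℕ) (he : 2 ≤ e) (hk : k = 1 ∨ k = e - 1) :
    ((k : ℚ) - 1) / e = max 0 ((2 * (k : ℚ) - e) / e) := by
  have he' : (2 : ℚ) ≤ (e : ℚ) := by exact_mod_cast he
  have hepos : (0 : ℚ) < (e : ℚ) := by linarith
  rcases hk with rfl | rfl
  · simp only [Nat.cast_one, sub_self, zero_div]
    symm
    apply max_eq_left
    apply div_nonpos_of_nonpos_of_nonneg <;> [linarith; exact hepos.le]
  · have h1 : (1 : ℕ) ≤ e := by omega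
    push_cast [Nat.cast_sub h1]
    have hnn : (0 : ℚ) ≤ (2 * ((e : ℚ) - 1) - e) / e := by
      apply div_nonneg <;> linarith
    rw [max_eq_right hnn]
    congr 1
    ring

/-- The unstarred case `k = 1`: the middle exponent is `0` (non-collapse of the cuspidal line by
THE LAW; for `ι(C₀)` the exponent is `v_p(c)`, so collapse iff `p ∣ c`). -/
theorem collapse_exponent_unstarred (e : ℕ) (he : 2 ≤ e) :
    max 0 ((2 * ((1:ℕ) : ℚ) - e) / e) = 0 := by
  have := collapse_exponent e 1 he (Or.inl rfl)
  simpa using this.symm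

end Summit.BirchSwinnertonDyer.BirchSwinnertonDyer.Cruxes.ManinPrimeToAdditiveFiveLe.DualCuspCollapse
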